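import Mathlib

/-!
# Imbrie (2016), the three-spin block: the hidden CHIRAL symmetry `S = Y₁ Z₂ Y₃`

[cite: ImbrieJSP2016, eq. (1.1), assumption LLA(ν, C)]  Repair cell b2b-imbrie, LLA.md block P
(gen 8), P18(c).  In the three-spin block `H = D + t₁X₁ + t₂X₂ + t₃X₃` of [ImbrieJSP2016, eq. (1.1)]
(landscape `D = c₀ + h₁σ₁ + h₂σ₂ + h₃σ₃ + J₁σ₁σ₂ + J₂σ₂σ₃`; conventions of `FlatPair` /
`UmbilicPlanes`, restated verbatim) every term EXCEPT the scalar `c₀` and the middle field `h₂σ₂`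
anticommutes with the real involution
`(Sψ)(σ₁,σ₂,σ₃) = −σ₁σ₂σ₃ · ψ(−σ₁, σ₂, −σ₃)`   (`S = Y₁ Z₂ Y₃`, a real symmetric orthogonal matrix).
Hence for `c₀ = h₂ = 0` the spectrum of `H` is symmetric under `E ↦ −E` (`S` maps the
`E`-eigenspace onto the `−E`-eigenspace), zero modes occur on the codimension-ONE set `det H = 0`,
and in the a-picture of bond (1,2) (`Σ_p a_p Π_p = c₀ + c₁σ₁ + c_zσ₂ + c₁₂σ₁σ₂`) the only
chirality-breaking parameters are the two sector means `c₀ ± c_z`.  Consequences recorded in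
LLA.md P18(c): the effective (free spin) ⊗ (partner pair) coupling at the umbilic families
`B_F(1)`, `B_F(3)` is EXACTLY proportional to `c_z` (second-order coefficient `c₁₂/f`), the level
crossings inside the hyperplane `c_z = 0` are exact (chiral zero modes), and every umbilic family of
the census lies in `{c_z = 0}` or in the classical set `t = 0`.
Finite identities over the 8 configurations; no analysis.
-/

namespace Literature.MathematicalPhysics.QuantumLattice.Imbrie2016

open Finset BigOperators

namespace Chirality

/-- [cite: ImbrieJSP2016, eq. (1.1)] spin value of a basis index: `0 ↦ +1`, `1 ↦ −1` (as in `FlatPair`). -/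
def sgn (a : Fin 2) : ℝ := if a = 0 then 1 else -1

/-- [cite: ImbrieJSP2016, eq. (1.1)] three-spin kets as real functions of the three basis indices (as in `FlatPair`). -/
abbrev Ket := Fin 2 → Fin 2 → Fin 2 → ℝ

/-- [cite: ImbrieJSP2016, eq. (1.1)] the transverse part `t₁X₁ + t₂X₂ + t₃X₃` (as in `FlatPair`). -/
def transverse (t₁ t₂ t₃ : ℝ) (ψ : Ket) : Ket :=
  fun a b c => t₁ * ψ a.rev b c + t₂ * ψ a b.rev c + t₃ * ψ a b c.rev

/-- [cite: ImbrieJSP2016, eq. (1.1)] the landscape (diagonal part, shift `c₀` adjoined; as in `FlatPair`). -/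
def landscape (c₀ h₁ h₂ h₃ J₁ J₂ : ℝ) (a b c : Fin 2) : ℝ :=
  c₀ + h₁ * sgn a + h₂ * sgn b + h₃ * sgn c + J₁ * sgn a * sgn b + J₂ * sgn b * sgn c

/-- [cite: ImbrieJSP2016, eq. (1.1)] the full block Hamiltonian `H = D + t₁X₁ + t₂X₂ + t₃X₃` acting on kets. -/
def ham (c₀ h₁ h₂ h₃ J₁ J₂ t₁ t₂ t₃ : ℝ) (ψ : Ket) : Ket :=
  fun a b c => landscape c₀ h₁ h₂ h₃ J₁ J₂ a b c * ψ a b c + transverse t₁ t₂ t₃ ψ a b c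

/-- [cite: ImbrieJSP2016, eq. (1.1)] the chiral involution `S = Y₁Z₂Y₃`:
`(Sψ)(σ) = −σ₁σ₂σ₃ ψ(−σ₁, σ₂, −σ₃)` (real, since `Y ⊗ Y` is real). -/
def chi (ψ : Ket) : Ket := fun a b c => -(sgn a * sgn b * sgn c) * ψ a.rev b c.rev

/-- [cite: ImbrieJSP2016, eq. (1.1)] `S` is an involution. -/
theorem chi_chi (ψ : Ket) : chi (chi ψ) = ψ := by
  funext a b c
  fin_cases a <;> fin_cases b <;> fin_cases c <;> norm_num [chi, sgn, Fin.rev]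

/-- [cite: ImbrieJSP2016, eq. (1.1)] `S` is symmetric (hence, being an involution, orthogonal) for
the real inner product: `Σ φ·(Sψ) = Σ (Sφ)·ψ`. -/
theorem chi_symmetric (φ ψ : Ket) :
    (∑ a, ∑ b, ∑ c, φ a b c * chi ψ a b c) = ∑ a, ∑ b, ∑ c, chi φ a b c * ψ a b c := by
  simp only [chi, Fin.sum_univ_two, sgn, Fin.rev]
  norm_num
  ring

/-- [cite: ImbrieJSP2016, eq. (1.1)] CHIRALITY: with the scalar `c₀` and the middle field `h₂`
switched off, `H` anticommutes with `S`:  `S(Hψ) = −H(Sψ)` for every ket and all remaining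
parameters `h₁ h₃ J₁ J₂ t₁ t₂ t₃`. -/
theorem chiral (h₁ h₃ J₁ J₂ t₁ t₂ t₃ : ℝ) (ψ : Ket) :
    chi (ham 0 h₁ 0 h₃ J₁ J₂ t₁ t₂ t₃ ψ) = fun a b c => -ham 0 h₁ 0 h₃ J₁ J₂ t₁ t₂ t₃ (chi ψ) a b c := by
  funext a b c
  fin_cases a <;> fin_cases b <;> fin_cases c <;>
    norm_num [chi, ham, landscape, transverse, sgn, Fin.rev] <;> ring

/-- [cite: ImbrieJSP2016, eq. (1.1)] The two chirality-breaking terms COMMUTE with `S`: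
`S((c₀ + h₂σ₂)ψ) = (c₀ + h₂σ₂)(Sψ)`. So `H − (c₀ + h₂σ₂)` is the chiral part of the block, and in the
a-picture the sector means `c₀ ± c_z` are the only non-chiral parameters. -/
theorem sectorMean_commutes (c₀ h₂ : ℝ) (ψ : Ket) :
    chi (fun a b c => (c₀ + h₂ * sgn b) * ψ a b c) = fun a b c => (c₀ + h₂ * sgn b) * chi ψ a b c := by
  funext a b c
  fin_cases a <;> fin_cases b <;> fin_cases c <;> norm_num [chi, sgn, Fin.rev]

/-- [cite: ImbrieJSP2016, eq. (1.1)] SPECTRAL REFLECTION: for `c₀ = h₂ = 0`, if `ψ` is an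
eigenvector with eigenvalue `E` then `Sψ` is an eigenvector with eigenvalue `−E`; in particular the
spectrum is symmetric about `0` and exact zero-mode crossings have codimension one. -/
theorem eigen_reflect (h₁ h₃ J₁ J₂ t₁ t₂ t₃ E : ℝ) (ψ : Ket)
    (hψ : ham 0 h₁ 0 h₃ J₁ J₂ t₁ t₂ t₃ ψ = fun a b c => E * ψ a b c) :
    ham 0 h₁ 0 h₃ J₁ J₂ t₁ t₂ t₃ (chi ψ) = fun a b c => -E * chi ψ a b c := by
  have h := chiral h₁ h₃ J₁ J₂ t₁ t₂ t₃ ψ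
  rw [hψ] at h
  funext a b c
  have h' := congrFun (congrFun (congrFun h a) b) c
  simp only [chi] at h' ⊢
  linarith

end Chirality

end Literature.MathematicalPhysics.QuantumLattice.Imbrie2016
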